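import Literature.IUT.HodgeTheaters.InitialThetaData
import Literature.NumberTheory.DiophantineGeometry.LocalReductionFiniteBadPlacesProofs
import Mathlib.RingTheory.Ideal.GoingUp
import Mathlib.RingTheory.DedekindDomain.Ideal.Lemmas
import Mathlib.RingTheory.Ideal.Norm.AbsNorm
import Mathlib.Data.Nat.PrimeFin
import HarnessLib

/-!
# [IUTchI] Definition 3.1 (e): the place index `V̲ ⥲ V_mod` of initial Θ-data — API and finiteness facts

S. Mochizuki, *Inter-universal Teichmüller theory I*, §3, Def. 3.1 (b), (e), kurims final manuscript
(May 2020) pp. 61–62 [claim: Mochizuki2012, status: disputed]; companion of `InitialThetaData.lean` (the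
REAL definition `InitialThetaData F K Fbar E l P`). Nothing of the series is asserted: every statement below
is an elementary CONSEQUENCE of the typed definition (classical algebraic number theory), proved in the
kernel, of the kind the consumers of the place index (prime-strips `{†𝒟_v}_{v ∈ V̲}` of [IUTchI] Def. 4.1 /
5.2 / 6.1, [IUTchII] Def. 4.9, [IUTchIII] Thm. 3.11, the fork files) re-derive or assume:

* (e) "`V̲ ⊆ V(K)` … induces a natural bijection `V̲ ⥲ V_mod`" as an `Equiv` (`vEquiv`) with inverse
  `v ↦ v̲` (`underline`) and both round trips; the partitions `V̲ = V̲^bad ⊔ V̲^good = V̲^non ⊔ V̲^arc` with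
  `V̲^bad ⊆ V̲^non`, `V̲^arc ⊆ V̲^good` (Def. 3.1 (b): "`V^good_mod := V_mod ∖ V^bad_mod`", "`V^bad_mod` … a
  nonempty set of nonarchimedean valuations");
* restriction of valuations along a finite extension preserves the (non)archimedean type and is SURJECTIVE
  ("the natural surjection `V(K) ↠ V_mod`": `InfinitePlace.comap_surjective`; going up for primes);
* **`V̲^bad` is FINITE** — not printed in Def. 3.1 (b), but it FOLLOWS: places over `V^bad_mod` are places of
  multiplicative, hence bad, reduction of `E_F`, which are finitely many (the tree's theorem
  `WeierstrassCurve.finite_badPlaces_holds`, Silverman AEC VII.5 / VIII.8). Proved Summits-side before by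
  abc-iut-c312-5 (`Summit.ABC.IUTFork.Thm311.Real.vbadMod_finite`); re-proved here since a `Literature`
  module cannot import a `Summits` one;
* **`V̲` is INFINITE** — `V_mod = V(F_mod)` is the set of ALL valuations of a number field, which has
  infinitely many primes (`infinite_heightOneSpectrum`: a maximal ideal over every rational prime, distinct
  primes giving distinct ideals). CONSEQUENCE recorded for the cell's merge canon (plan/L6/MERGE-MAP.md §4
  C9-d): `IsEmpty (Fintype ↥D.V)` — a place kit demanding `[Fintype V]` (e.g. `PMBaseKit.fintypeV`,
  `RealifiedGlobalFrobenioid (V) [Fintype V]`) has NO instance with `V := ↥D.V`; the Fintype-free shape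
  (`V : Type`, `V^bad : Set V` finite — `Thm311.ThetaIndex` of abc-iut-c312-1/5) does. What does carry a
  `Fintype` is every TRUNCATION `V̲_S := {v̲ | v ∈ S}` to a finite `S ⊆ V_mod` (`VOver`, `fintypeVOver`),
  e.g. `S ⊇ V^bad_mod`; using a truncation in place of `V̲` would be a recorded weakening of
  "`{†𝒟_v}_{v ∈ V̲}`", not something the text does.

No statement of the paper is strengthened; the modelling remark takes no side on any disputed claim.
-/

namespace Literature.IUT.HodgeTheaters

open NumberField IsDedekindDomain

universe u v w

/-! ### Restriction of valuations along a finite extension `L ⊆ M` of number fields -/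

namespace Val

variable (L : Type u) {M : Type v} [Field L] [NumberField L] [Field M] [NumberField M] [Algebra L M]

/-- Restriction sends the nonarchimedean valuation of a prime `𝔓` of `𝓞 M` to that of the prime
`𝔓 ∩ 𝓞 L` below it (definitional unfolding of `Val.restrict`). [folklore] -/
private theorem restrict_non (w : FinitePlace M) :
    Val.restrict L (Val.non w) =
      Val.non (FinitePlace.mk ((FinitePlace.maximalIdeal w).under (𝓞 L))) := rfl

/-- Restriction preserves "nonarchimedean" ([IUTchI] §0 p. 35: `V(F) = V(F)^arc ∪ V(F)^non`; restriction
of valuations respects the two kinds). [cite: Mochizuki2012, §0 p.35] -/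
theorem isNon_restrict_iff (w : Val M) : (Val.restrict L w).IsNon ↔ w.IsNon := by
  cases w <;> exact Iff.rfl

/-- **Every valuation of `L` extends to `M`**: restriction of valuations `V(M) → V(L)` along a finite
extension of number fields is surjective (archimedean: `InfinitePlace.comap_surjective`; nonarchimedean:
over every prime of `𝓞 L` lies a prime of `𝓞 M`, going up). This is the content of "the natural
surjection `V(K) ↠ V_mod`" in [IUTchI] Def. 3.1 (e), p. 62 — PROVED (classical).
[claim: Mochizuki2012, status: disputed] -/
theorem restrict_surjective : Function.Surjective (Val.restrict L (M := M)) := by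
  rintro (u | u)
  · obtain ⟨w, rfl⟩ := InfinitePlace.comap_surjective (K := M) u
    exact ⟨Val.arc w, rfl⟩
  · haveI := (FinitePlace.maximalIdeal u).isMaximal
    haveI : FaithfulSMul (𝓞 L) (𝓞 M) :=
      (faithfulSMul_iff_algebraMap_injective (𝓞 L) (𝓞 M)).mpr
        (RingOfIntegers.algebraMap.injective L M)
    obtain ⟨P, hP, hPover⟩ :=
      Ideal.exists_maximal_ideal_liesOver_of_isIntegral (S := 𝓞 M) (FinitePlace.maximalIdeal u).asIdeal
    have hPne : P ≠ ⊥ :=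
      Ideal.ne_bot_of_liesOver_of_ne_bot (FinitePlace.maximalIdeal u).ne_bot P
    let v : HeightOneSpectrum (𝓞 M) := ⟨P, hP.isPrime, hPne⟩
    have hv : v.under (𝓞 L) = FinitePlace.maximalIdeal u :=
      HeightOneSpectrum.ext hPover.over.symm
    refine ⟨Val.non (FinitePlace.mk v), ?_⟩
    rw [restrict_non, FinitePlace.maximalIdeal_mk, hv, FinitePlace.mk_maximalIdeal]
    rfl

end Val

/-! ### A number field has infinitely many valuations -/

section Infinitude

variable (L : Type u) [Field L] [NumberField L]

/-- Over every rational prime `p` lies a nonzero prime of `𝓞 L` containing `p`: the ideal `(p)` of `𝓞 L`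
has absolute norm `p ^ [L:ℚ] ≠ 1`, so it is proper and lies in a maximal ideal. [folklore] -/
private theorem exists_heightOneSpectrum_natCast_mem {p : ℕ} (hp : p.Prime) :
    ∃ P : HeightOneSpectrum (𝓞 L), (p : 𝓞 L) ∈ P.asIdeal := by
  have hne : Ideal.span {(p : 𝓞 L)} ≠ ⊤ := by
    intro htop
    have h1 := (Ideal.absNorm_eq_one_iff (I := Ideal.span {(p : 𝓞 L)})).mpr htop
    rw [Ideal.absNorm_span_natCast, RingOfIntegers.rank] at h1
    have hpos : 0 < Module.finrank ℚ L := Module.finrank_pos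
    have : p ^ Module.finrank ℚ L ≠ 1 := by
      have h2 : 2 ≤ p := hp.two_le
      have : p ≤ p ^ Module.finrank ℚ L := Nat.le_self_pow hpos.ne' p
      omega
    exact this h1
  obtain ⟨Q, hQmax, hle⟩ := Ideal.exists_le_maximal _ hne
  have hp0 : (p : 𝓞 L) ≠ 0 := by exact_mod_cast hp.ne_zero
  have hpQ : (p : 𝓞 L) ∈ Q := hle (Ideal.subset_span rfl)
  refine ⟨⟨Q, hQmax.isPrime, ?_⟩, hpQ⟩
  intro hQ
  rw [hQ, Ideal.mem_bot] at hpQ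
  exact hp0 hpQ

/-- **A number field has infinitely many primes**: the nonzero primes of `𝓞 L` form an infinite set
(distinct rational primes are coprime, so they lie in distinct maximal ideals; there are infinitely many
rational primes). [folklore] -/
private theorem infinite_heightOneSpectrum : Infinite (HeightOneSpectrum (𝓞 L)) := by
  classical
  choose P hP using fun p : {p : ℕ // p.Prime} => exists_heightOneSpectrum_natCast_mem L p.2
  haveI : Infinite {p : ℕ // p.Prime} := Set.infinite_coe_iff.mpr Nat.infinite_setOf_prime
  refine Infinite.of_injective P ?_
  intro p q hpq
  by_contra hne
  have hcop : Nat.Coprime p.1 q.1 :=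
    (Nat.coprime_primes p.2 q.2).mpr fun h => hne (Subtype.ext h)
  obtain ⟨a, b, hab⟩ := hcop.cast (R := 𝓞 L)
  have hq : ((q.1 : ℕ) : 𝓞 L) ∈ (P p).asIdeal := by
    rw [hpq]
    exact hP q
  have h1 : (1 : 𝓞 L) ∈ (P p).asIdeal := by
    rw [← hab]
    exact Ideal.add_mem _ (Ideal.mul_mem_left _ _ (hP p)) (Ideal.mul_mem_left _ _ hq)
  exact (P p).isPrime.ne_top ((Ideal.eq_top_iff_one _).mpr h1)

/-- A number field has infinitely many finite places (`FinitePlace.mk` is injective on primes, with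
left inverse `FinitePlace.maximalIdeal`). [folklore] -/
private theorem infinite_finitePlace : Infinite (FinitePlace L) := by
  haveI := infinite_heightOneSpectrum L
  refine Infinite.of_injective (fun v : HeightOneSpectrum (𝓞 L) => FinitePlace.mk v) ?_
  intro v v' h
  have := congrArg FinitePlace.maximalIdeal h
  simpa only [FinitePlace.maximalIdeal_mk] using this

/-- `V(L)` is infinite for every number field `L`. [folklore] -/
private theorem infinite_val : Infinite (Val L) := by
  haveI := infinite_finitePlace L
  exact Infinite.of_injective (Val.non (F := L)) Sum.inr_injective

end Infinitude

/-! ### The place index of initial Θ-data ([IUTchI] Def. 3.1 (b), (e)) -/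

section Places

variable {F : Type u} {K : Type v} {Fbar : Type w} [Field F] [NumberField F] [Field K]
  [NumberField K] [Algebra F K] [Field Fbar] [Algebra F Fbar] [Algebra K Fbar]
  {E : WeierstrassCurve F} [E.IsElliptic] {l : ℕ} {P : BadPlacePredicates K}
  (D : InitialThetaData F K Fbar E l P)

namespace InitialThetaData

/-- `V̲ → V_mod` is injective (Def. 3.1 (e): "a natural bijection `V̲ ⥲ V_mod`").
[claim: Mochizuki2012, status: disputed] -/
theorem toVMod_injOn : Set.InjOn (toVMod F K E) D.V := D.V_bijOn.injOn

/-- Two members of `V̲` over the same `v ∈ V_mod` are equal. [claim: Mochizuki2012, status: disputed] -/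
theorem eq_of_toVMod_eq {w w' : Val K} (hw : w ∈ D.V) (hw' : w' ∈ D.V)
    (h : toVMod F K E w = toVMod F K E w') : w = w' :=
  D.toVMod_injOn hw hw' h

/-- The round trip `V̲ → V_mod → V̲` is the identity: `(v̲_w)` for `w ∈ V̲` is `w`
(`underline ∘ toVMod = id` on `V̲`). [claim: Mochizuki2012, status: disputed] -/
theorem underline_toVMod {w : Val K} (hw : w ∈ D.V) : D.underline (toVMod F K E w) = w :=
  D.eq_of_toVMod_eq (D.underline_mem _) hw (D.toVMod_underline _)

/-- `v ↦ v̲` is injective. [claim: Mochizuki2012, status: disputed] -/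
theorem underline_injective : Function.Injective D.underline := by
  intro v v' h
  rw [← D.toVMod_underline v, ← D.toVMod_underline v', h]

/-- **Def. 3.1 (e) as an `Equiv`**: the natural bijection `V̲ ⥲ V_mod` (forward: restriction of
valuations `toVMod`; inverse: `v ↦ v̲`). [claim: Mochizuki2012, status: disputed] -/
noncomputable def vEquiv : ↥D.V ≃ Val (fieldOfModuli E) where
  toFun w := toVMod F K E (w : Val K)
  invFun v := ⟨D.underline v, D.underline_mem v⟩
  left_inv w := Subtype.ext (D.underline_toVMod w.2)
  right_inv v := D.toVMod_underline v

/-- `vEquiv` is `toVMod` on `V̲`. [claim: Mochizuki2012, status: disputed] -/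
@[simp] theorem vEquiv_apply (w : ↥D.V) : D.vEquiv w = toVMod F K E (w : Val K) := rfl

/-- `vEquiv⁻¹` is `v ↦ v̲`. [claim: Mochizuki2012, status: disputed] -/
@[simp] theorem vEquiv_symm_apply (v : Val (fieldOfModuli E)) :
    ((D.vEquiv.symm v : ↥D.V) : Val K) = D.underline v := rfl

/-! #### The partition of `V̲` -/

/-- `V̲ = V̲^bad ∪ V̲^good` (Def. 3.1 (b): "`V^good_mod := V_mod ∖ V^bad_mod`").
[claim: Mochizuki2012, status: disputed] -/
theorem Vbad_union_Vgood : D.Vbad ∪ D.Vgood = D.V := by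
  ext w
  constructor
  · rintro (h | h)
    · exact h.1
    · exact h.1
  · intro hw
    by_cases h : toVMod F K E w ∈ Val.non '' D.VbadMod
    · exact Or.inl ⟨hw, h⟩
    · exact Or.inr ⟨hw, h⟩

/-- `V̲^bad ∩ V̲^good = ∅`. [claim: Mochizuki2012, status: disputed] -/
theorem disjoint_Vbad_Vgood : Disjoint D.Vbad D.Vgood :=
  Set.disjoint_left.mpr fun _ hb hg => hg.2 hb.2

/-- `V̲ = V̲^non ∪ V̲^arc` ([IUTchI] §0: `V(K) = V(K)^arc ∪ V(K)^non`). [claim: Mochizuki2012, status: disputed] -/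
theorem Vnon_union_Varc : D.Vnon ∪ D.Varc = D.V := by
  ext w
  constructor
  · rintro (h | h)
    · exact h.1
    · exact h.1
  · intro hw
    rcases Val.isArc_or_isNon w with ⟨ha, _⟩ | ⟨hn, _⟩
    · exact Or.inr ⟨hw, ha⟩
    · exact Or.inl ⟨hw, hn⟩

/-- `V̲^non ∩ V̲^arc = ∅`. [claim: Mochizuki2012, status: disputed] -/
theorem disjoint_Vnon_Varc : Disjoint D.Vnon D.Varc :=
  Set.disjoint_left.mpr fun w hn ha => by
    rcases Val.isArc_or_isNon w with ⟨_, h⟩ | ⟨_, h⟩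
    · exact h hn.2
    · exact h ha.2

/-- The places over `V^bad_mod` are nonarchimedean: `toVMod w ∈ V(F_mod)^non` forces `w ∈ V(K)^non`
(restriction preserves the type). [claim: Mochizuki2012, status: disputed] -/
theorem isNon_of_toVMod_mem_image_non {w : Val K} {S : Set (FinitePlace (fieldOfModuli E))}
    (h : toVMod F K E w ∈ Val.non '' S) : w.IsNon := by
  obtain ⟨u, _, hu⟩ := h
  have hnon : (toVMod F K E w).IsNon := by rw [← hu]; rfl
  unfold toVMod at hnon
  rwa [Val.isNon_restrict_iff, Val.isNon_restrict_iff] at hnon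

/-- **`V̲^bad ⊆ V̲^non`** (Def. 3.1 (b): "`V^bad_mod` … a nonempty set of nonarchimedean valuations").
[claim: Mochizuki2012, status: disputed] -/
theorem Vbad_subset_Vnon : D.Vbad ⊆ D.Vnon := fun _ h =>
  ⟨h.1, isNon_of_toVMod_mem_image_non (E := E) h.2⟩

/-- **`V̲^arc ⊆ V̲^good`** (archimedean places are good). [claim: Mochizuki2012, status: disputed] -/
theorem Varc_subset_Vgood : D.Varc ⊆ D.Vgood := fun w h =>
  ⟨h.1, fun hb => by
    rcases Val.isArc_or_isNon w with ⟨_, hn⟩ | ⟨_, ha⟩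
    · exact hn (isNon_of_toVMod_mem_image_non (E := E) hb)
    · exact ha h.2⟩

/-- `v̲ ∈ V̲^bad` for `v ∈ V^bad_mod` ("write `v̲ ∈ V̲` for the element of `V̲` that corresponds to `v`",
Ex. 3.5 (i)). [claim: Mochizuki2012, status: disputed] -/
theorem underline_mem_Vbad {u : FinitePlace (fieldOfModuli E)} (hu : u ∈ D.VbadMod) :
    D.underline (Val.non u) ∈ D.Vbad :=
  ⟨D.underline_mem _, by rw [D.toVMod_underline]; exact ⟨u, hu, rfl⟩⟩

/-- `V̲^bad` is nonempty (Def. 3.1 (b): "`V^bad_mod` … is a nonempty set").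
[claim: Mochizuki2012, status: disputed] -/
theorem Vbad_nonempty : D.Vbad.Nonempty := by
  obtain ⟨u, hu⟩ := D.VbadMod_nonempty
  exact ⟨_, D.underline_mem_Vbad hu⟩

/-! #### Truncations `V̲_S` of the index to a set `S ⊆ V_mod` -/

/-- `V̲_S := {v̲ ∈ V̲ | v ∈ S}`, the members of `V̲` over a set `S ⊆ V_mod` of indices (so `V̲^bad = V̲_S` for
`S = V^bad_mod`, `V̲^good` for its complement). [claim: Mochizuki2012, status: disputed] -/
def VOver (S : Set (Val (fieldOfModuli E))) : Set (Val K) := {w ∈ D.V | toVMod F K E w ∈ S}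

/-- `V̲^bad = V̲_{V^bad_mod}`. [claim: Mochizuki2012, status: disputed] -/
theorem Vbad_eq_VOver : D.Vbad = D.VOver (Val.non '' D.VbadMod) := rfl

/-- `V̲_S` is the image of `S` under `v ↦ v̲`. [claim: Mochizuki2012, status: disputed] -/
theorem VOver_eq_image (S : Set (Val (fieldOfModuli E))) : D.VOver S = D.underline '' S := by
  ext w
  constructor
  · rintro ⟨hw, hS⟩
    exact ⟨_, hS, D.underline_toVMod hw⟩
  · rintro ⟨v, hv, rfl⟩
    exact ⟨D.underline_mem v, by rw [D.toVMod_underline]; exact hv⟩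

/-- The bijection `V̲ ⥲ V_mod` restricts to `V̲_S ⥲ S`. [claim: Mochizuki2012, status: disputed] -/
noncomputable def vOverEquiv (S : Set (Val (fieldOfModuli E))) : ↥(D.VOver S) ≃ ↥S where
  toFun w := ⟨toVMod F K E (w : Val K), w.2.2⟩
  invFun v := ⟨D.underline v, D.underline_mem _, by rw [D.toVMod_underline]; exact v.2⟩
  left_inv w := Subtype.ext (D.underline_toVMod w.2.1)
  right_inv v := Subtype.ext (D.toVMod_underline v)

/-- **`V̲_S` is finite iff `S` is.** [claim: Mochizuki2012, status: disputed] -/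
theorem VOver_finite_iff (S : Set (Val (fieldOfModuli E))) : (D.VOver S).Finite ↔ S.Finite := by
  rw [← Set.finite_coe_iff, ← Set.finite_coe_iff]
  exact Equiv.finite_iff (D.vOverEquiv S)

/-- For a FINITE set of indices `S ⊆ V_mod` (e.g. any finite `S ⊇ V^bad_mod`), the truncation `V̲_S`
carries a `Fintype` — this, and not `V̲` itself (`isEmpty_fintype_V`), is what a `[Fintype V]`-indexed kit
can be instantiated on. [claim: Mochizuki2012, status: disputed] -/
noncomputable instance fintypeVOver (S : Finset (Val (fieldOfModuli E))) :
    Fintype ↥(D.VOver (↑S)) :=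
  ((D.VOver_finite_iff _).mpr S.finite_toSet).fintype

/-! #### Finiteness of `V̲^bad`, infinitude of `V̲` -/

/-- The finite place of `F_mod` below a finite place of `F`. [folklore] -/
noncomputable def finBelow (x : FinitePlace F) : FinitePlace (fieldOfModuli E) :=
  FinitePlace.mk ((FinitePlace.maximalIdeal x).under (𝓞 (fieldOfModuli E)))

omit [NumberField K] [Algebra F K] [Algebra F Fbar] [Algebra K Fbar] in
/-- Restriction of a nonarchimedean valuation of `F` to `F_mod` is `finBelow`. [folklore] -/
private theorem restrict_non_eq_finBelow (x : FinitePlace F) :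
    Val.restrict (fieldOfModuli E) (Val.non x) = Val.non (finBelow (E := E) x) := rfl

/-- **`V(F)^bad` is finite**: at a place of `F` over `V^bad_mod` the curve `E_F` has multiplicative —
hence not good — reduction (`multiplicative_over_VbadMod`, Def. 3.1 (b)), and `E_F` has only finitely
many places of bad reduction (the tree's theorem `WeierstrassCurve.finite_badPlaces_holds`) — PROVED (classical).
[claim: Mochizuki2012, status: disputed] -/
theorem VFbad_finite : D.VFbad.Finite := by
  have hbad : (E.badPlaces (𝓞 F)).Finite := WeierstrassCurve.finite_badPlaces_holds (𝓞 F) E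
  have hpre : {x : FinitePlace F | FinitePlace.maximalIdeal x ∈ E.badPlaces (𝓞 F)}.Finite :=
    Set.Finite.preimage (fun _ _ _ _ h => FinitePlace.maximalIdeal_injective h) hbad
  refine hpre.subset ?_
  intro x hx
  show FinitePlace.maximalIdeal x ∈ E.badPlaces (𝓞 F)
  rw [WeierstrassCurve.mem_badPlaces_iff]
  exact (D.multiplicative_over_VbadMod x hx).not_hasGoodReductionAt

/-- **`V^bad_mod` is finite**: every `u ∈ V^bad_mod` is below some finite place of `F`
(`Val.restrict_surjective`), which lies in the finite set `V(F)^bad`. Literature-side twin of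
abc-iut-c312-5's `Summit.ABC.IUTFork.Thm311.Real.vbadMod_finite` (which a `Literature` module cannot
import) — PROVED (classical). [claim: Mochizuki2012, status: disputed] -/
theorem VbadMod_finite : D.VbadMod.Finite := by
  refine (D.VFbad_finite.image (finBelow (E := E))).subset ?_
  intro u hu
  obtain ⟨x, hx⟩ := Val.restrict_surjective (fieldOfModuli E) (M := F) (Val.non u)
  rcases x with y | x
  · exact absurd hx Sum.inl_ne_inr
  · have hxu : finBelow (E := E) x = u := Sum.inr_injective hx
    refine ⟨x, ?_, hxu⟩
    show Val.restrict (fieldOfModuli E) (Val.non x) ∈ Val.non '' D.VbadMod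
    rw [restrict_non_eq_finBelow, hxu]
    exact ⟨u, hu, rfl⟩

/-- **`V̲^bad` is finite.** [claim: Mochizuki2012, status: disputed] -/
theorem Vbad_finite : D.Vbad.Finite := by
  rw [Vbad_eq_VOver, VOver_finite_iff]
  exact D.VbadMod_finite.image _

/-- **`V_mod` is infinite**: `V_mod = V(F_mod)` (Def. 3.1 (b)) is the set of ALL valuations of the number field
`F_mod`, which has infinitely many primes — PROVED (classical). [claim: Mochizuki2012, status: disputed] -/
theorem VMod_infinite : (Set.univ : Set (Val (fieldOfModuli E))).Infinite :=
  @Set.infinite_univ _ (infinite_val _)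

/-- **`V̲` is infinite**: it is in bijection with `V_mod` (Def. 3.1 (e)). [claim: Mochizuki2012, status: disputed] -/
theorem V_infinite : D.V.Infinite := by
  intro h
  have himg := h.image (toVMod F K E)
  rw [D.V_bijOn.image_eq] at himg
  exact VMod_infinite (E := E) himg

/-- `V̲` is infinite, as a type. [claim: Mochizuki2012, status: disputed] -/
theorem infinite_coe_V : Infinite ↥D.V := Set.infinite_coe_iff.mpr D.V_infinite

/-- **No `Fintype` on `V̲`.** Consequence for the cell's merge canon (C9-d): a place kit whose index
carries `[Fintype V]` has no instance with `V := ↥D.V` for ANY initial Θ-data `D`; only truncations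
`V̲_S` (`fintypeVOver`) or a Fintype-free kit can be instantiated from the real definition.
[claim: Mochizuki2012, status: disputed] -/
theorem isEmpty_fintype_V : IsEmpty (Fintype ↥D.V) :=
  ⟨fun _ => D.V_infinite (Set.toFinite D.V)⟩

/-- `V̲^good` is infinite (it is `V̲` minus the finite set `V̲^bad`). [claim: Mochizuki2012, status: disputed] -/
theorem Vgood_infinite : D.Vgood.Infinite := by
  intro h
  apply D.V_infinite
  rw [← D.Vbad_union_Vgood]
  exact D.Vbad_finite.union h

end InitialThetaData

end Places

end Literature.IUT.HodgeTheaters
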